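import Summits.Ventures.PercRepro.RankLevelSetExplicitLin2KeyL

/-!
# PercRepro — THE LEVEL-16 THEOREM-M ROW OF C-025 (SHARP): THE KEY AT `p = 66 440`, PART B: chunks 9 … 16 of 32 (p4, S4 feed)

`proofs/P4-gen18.md`. The THEOREM-M key `KeyL 16 66440 d` (RankLevelSetExplicitLin2KeyL) at the coranks of the level-16 row
`16401 … 32784`, by the kernel (`decide`, 8 chunks of 2 048); the row is assembled in
RankLevelSetExplicitLin2IndepRowSSixteen. Axioms: standard.
-/

namespace PercRepro

namespace ThmN

namespace Explicit

/-- The THEOREM-M key row at `(q, p) = (16, 66 440)`, chunk 9 of 32: coranks `16401 … 18448`, by the kernel. -/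
theorem key_sixteen_indepS_row_9 : ∀ t < 2048, KeyL 16 66440 (17 + (16384 + t)) := by decide +kernel

/-- The THEOREM-M key row at `(q, p) = (16, 66 440)`, chunk 10 of 32: coranks `18449 … 20496`, by the kernel. -/
theorem key_sixteen_indepS_row_10 : ∀ t < 2048, KeyL 16 66440 (17 + (18432 + t)) := by decide +kernel

/-- The THEOREM-M key row at `(q, p) = (16, 66 440)`, chunk 11 of 32: coranks `20497 … 22544`, by the kernel. -/
theorem key_sixteen_indepS_row_11 : ∀ t < 2048, KeyL 16 66440 (17 + (20480 + t)) := by decide +kernel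

/-- The THEOREM-M key row at `(q, p) = (16, 66 440)`, chunk 12 of 32: coranks `22545 … 24592`, by the kernel. -/
theorem key_sixteen_indepS_row_12 : ∀ t < 2048, KeyL 16 66440 (17 + (22528 + t)) := by decide +kernel

/-- The THEOREM-M key row at `(q, p) = (16, 66 440)`, chunk 13 of 32: coranks `24593 … 26640`, by the kernel. -/
theorem key_sixteen_indepS_row_13 : ∀ t < 2048, KeyL 16 66440 (17 + (24576 + t)) := by decide +kernel

/-- The THEOREM-M key row at `(q, p) = (16, 66 440)`, chunk 14 of 32: coranks `26641 … 28688`, by the kernel. -/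
theorem key_sixteen_indepS_row_14 : ∀ t < 2048, KeyL 16 66440 (17 + (26624 + t)) := by decide +kernel

/-- The THEOREM-M key row at `(q, p) = (16, 66 440)`, chunk 15 of 32: coranks `28689 … 30736`, by the kernel. -/
theorem key_sixteen_indepS_row_15 : ∀ t < 2048, KeyL 16 66440 (17 + (28672 + t)) := by decide +kernel

/-- The THEOREM-M key row at `(q, p) = (16, 66 440)`, chunk 16 of 32: coranks `30737 … 32784`, by the kernel. -/
theorem key_sixteen_indepS_row_16 : ∀ t < 2048, KeyL 16 66440 (17 + (30720 + t)) := by decide +kernel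

end Explicit

end ThmN

end PercRepro
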